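import Mathlib
import HarnessLib


/-!
# `CurvatureKernelBound` (stmt-QuantumFields-11687), line `coupling-trichotomy` — brick `LogConvexExpDecay` (+ rider
# `LogConvexChordBound`) of the swap-mirror programme toward `Stub.FiniteCouplingStrongSubextensive` (skeleton v9)

Pure real analysis, the analytic core of a reflection-positivity argument. A non-negative sequence `E : ℕ → ℝ` that is
discretely LOG-CONVEX, `E u ^ 2 ≤ E (u-1) * E (u+1)` (think `E u = ⟪ψ, T^{2u} ψ⟫` for a positive contraction `T`), lies below
its geometric chord: `E u ≤ E 0 ^ (1 - u/U) * E U ^ (u/U)` for `0 ≤ u ≤ U` (`LogConvexChordBound`, `Real.rpow`). Consequently,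
if `E U ≤ K e^{-μ U}` for arbitrarily large `U` then `E u ≤ E 0 · e^{-μ u}` for EVERY `u` (`LogConvexExpDecay`): the decay
rate seen at infinity already holds from the first step, with constant `E 0`.

Proof: a positive interior term forces positivity of the whole window (`E w ^ 2 ≤ E (w-1) E (w+1)`), so either `E u = 0`
(trivial) or all terms are positive and `a := log ∘ E` is discretely convex; its increments are monotone, whence
`U · (a u − a 0) ≤ u · (a U − a 0)` by comparing the first `u` increments with the last `U − u` ones; exponentiate. For the
decay statement combine the log-level chord bound with `a U ≤ log K − μ U` along the frequent `U → ∞` and let `U → ∞`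
(Archimedean argument). [folklore]
-/

noncomputable section

open scoped BigOperators Topology
open Filter Set

namespace Summit.QuantumFields.YangMills.Theorems.CurvatureKernel

namespace LogConvex

/-- Increments of a discretely convex real sequence are monotone on the window: for `i ≤ j < U`,
`a (i+1) - a i ≤ a (j+1) - a j`. [folklore] -/
theorem incr_mono (a : ℕ → ℝ) (U : ℕ)
    (h : ∀ v, 0 < v → v < U → 2 * a v ≤ a (v - 1) + a (v + 1)) :
    ∀ i j, i ≤ j → j < U → a (i + 1) - a i ≤ a (j + 1) - a j := by
  intro i j hij
  induction j, hij using Nat.le_induction with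
  | base => intro _; exact le_rfl
  | succ j _ ih =>
    intro hjU
    have h1 := ih (by omega)
    have h2 := h (j + 1) (Nat.succ_pos j) hjU
    simp only [Nat.add_sub_cancel] at h2
    linarith

/-- A discretely convex real sequence lies below its chord over `[0, U]`, in cleared-denominator form:
`U · (a u − a 0) ≤ u · (a U − a 0)` for `u ≤ U`. [folklore] -/
theorem le_chord (a : ℕ → ℝ) (U : ℕ)
    (h : ∀ v, 0 < v → v < U → 2 * a v ≤ a (v - 1) + a (v + 1)) :
    ∀ u, u ≤ U → (U : ℝ) * (a u - a 0) ≤ (u : ℝ) * (a U - a 0) := by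
  intro u hu
  have hmono := incr_mono a U h
  rcases Nat.eq_zero_or_pos u with rfl | hu0
  · simp
  have tel : ∀ n, ∑ k ∈ Finset.range n, (a (k + 1) - a k) = a n - a 0 := fun n => Finset.sum_range_sub a n
  have hS : a U - a 0 = (a u - a 0) + ∑ k ∈ Finset.Ico u U, (a (k + 1) - a k) := by
    rw [← tel U, ← tel u, Finset.sum_range_add_sum_Ico _ hu]
  have h1 : a u - a 0 ≤ (u : ℝ) * (a u - a (u - 1)) := by
    have := Finset.sum_le_card_nsmul (Finset.range u) (fun k => a (k + 1) - a k) (a u - a (u - 1)) ?_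
    · rw [tel u, Finset.card_range, nsmul_eq_mul] at this
      exact this
    · intro k hk
      rw [Finset.mem_range] at hk
      have := hmono k (u - 1) (by omega) (by omega)
      rwa [Nat.sub_add_cancel hu0] at this
  have h2 : ((U : ℝ) - u) * (a u - a (u - 1)) ≤ ∑ k ∈ Finset.Ico u U, (a (k + 1) - a k) := by
    have := Finset.card_nsmul_le_sum (Finset.Ico u U) (fun k => a (k + 1) - a k) (a u - a (u - 1)) ?_
    · rw [Nat.card_Ico, nsmul_eq_mul, Nat.cast_sub hu] at this
      exact this
    · intro k hk
      rw [Finset.mem_Ico] at hk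
      have := hmono (u - 1) k (by omega) (by omega)
      rwa [Nat.sub_add_cancel hu0] at this
  have hUu : (0 : ℝ) ≤ (U : ℝ) - u := sub_nonneg.mpr (Nat.cast_le.mpr hu)
  have h3 : ((U : ℝ) - u) * (a u - a 0) ≤ ((U : ℝ) - u) * ((u : ℝ) * (a u - a (u - 1))) :=
    mul_le_mul_of_nonneg_left h1 hUu
  have h4 : (u : ℝ) * (((U : ℝ) - u) * (a u - a (u - 1))) ≤ (u : ℝ) * ∑ k ∈ Finset.Ico u U, (a (k + 1) - a k) :=
    mul_le_mul_of_nonneg_left h2 (Nat.cast_nonneg u)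
  rw [hS]
  linarith

/-- A discretely convex real sequence lies below its chord over `[0, U]` (`0 < U`):
`a u ≤ (1 − u/U) · a 0 + (u/U) · a U` for `u ≤ U`. [folklore] -/
theorem le_chord_div (a : ℕ → ℝ) (U : ℕ) (hU : 0 < U)
    (h : ∀ v, 0 < v → v < U → 2 * a v ≤ a (v - 1) + a (v + 1)) (u : ℕ) (hu : u ≤ U) :
    a u ≤ (1 - (u : ℝ) / U) * a 0 + ((u : ℝ) / U) * a U := by
  have key := le_chord a U h u hu
  have hUpos : (0 : ℝ) < U := by exact_mod_cast hU
  have : (1 - (u : ℝ) / U) * a 0 + ((u : ℝ) / U) * a U - a u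
      = ((u : ℝ) * (a U - a 0) - (U : ℝ) * (a u - a 0)) / U := by
    field_simp
    ring
  rw [← sub_nonneg, this]
  exact div_nonneg (by linarith) hUpos.le

/-- In a log-convex step `E w ^ 2 ≤ E (w-1) * E (w+1)` with non-negative neighbours, positivity of the middle term forces
positivity of both neighbours. [folklore] -/
theorem pos_neighbours (E : ℕ → ℝ) (w : ℕ) (h0 : 0 ≤ E (w - 1)) (h2 : 0 ≤ E (w + 1))
    (hlc : E w ^ 2 ≤ E (w - 1) * E (w + 1)) (hw : 0 < E w) : 0 < E (w - 1) ∧ 0 < E (w + 1) := by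
  have hprod : 0 < E (w - 1) * E (w + 1) := lt_of_lt_of_le (pow_pos hw 2) hlc
  exact ⟨pos_of_mul_pos_left hprod h2, pos_of_mul_pos_right hprod h0⟩

/-- If a non-negative sequence is log-convex on the window `[0, U]` and positive at one INTERIOR point `0 < u < U`, it is
positive on the whole window. [folklore] -/
theorem all_pos (E : ℕ → ℝ) (U : ℕ) (hnn : ∀ v, v ≤ U → 0 ≤ E v)
    (hlc : ∀ v, 0 < v → v < U → E v ^ 2 ≤ E (v - 1) * E (v + 1))
    (u : ℕ) (hu0 : 0 < u) (huU : u < U) (hpos : 0 < E u) : ∀ v, v ≤ U → 0 < E v := by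
  have up : ∀ v, u ≤ v → v ≤ U → 0 < E v := by
    intro v huv
    induction v, huv using Nat.le_induction with
    | base => intro _; exact hpos
    | succ v huv ih =>
      intro hvU
      have hv : 0 < E v := ih (Nat.le_of_succ_le hvU)
      exact (pos_neighbours E v (hnn _ (by omega)) (hnn _ hvU) (hlc v (by omega) (by omega)) hv).2
  have down : ∀ k, k ≤ u → 0 < E (u - k) := by
    intro k
    induction k with
    | zero => intro _; simpa using hpos
    | succ k ih =>
      intro hk
      have hk' : 0 < E (u - k) := ih (Nat.le_of_succ_le hk)
      have := (pos_neighbours E (u - k) (hnn _ (by omega)) (hnn _ (by omega))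
        (hlc (u - k) (by omega) (by omega)) hk').1
      have e : u - (k + 1) = u - k - 1 := by omega
      rw [e]
      exact this
  intro v hvU
  rcases le_or_gt u v with huv | hvu
  · exact up v huv hvU
  · have := down (u - v) (Nat.sub_le u v)
    rwa [Nat.sub_sub_self hvu.le] at this

/-- Log-convexity of a positive sequence is discrete convexity of its logarithm:
`2 log E v ≤ log E (v-1) + log E (v+1)`. [folklore] -/
theorem two_mul_log_le (E : ℕ → ℝ) (v : ℕ) (h1 : 0 < E (v - 1)) (h2 : 0 < E v) (h3 : 0 < E (v + 1))
    (hlc : E v ^ 2 ≤ E (v - 1) * E (v + 1)) :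
    2 * Real.log (E v) ≤ Real.log (E (v - 1)) + Real.log (E (v + 1)) := by
  have := Real.log_le_log (pow_pos h2 2) hlc
  rw [Real.log_pow, Real.log_mul h1.ne' h3.ne'] at this
  exact_mod_cast this

/-- Log-level chord bound for a sequence positive on `[0, U]` (`0 < U`) and log-convex on its interior:
`log E u ≤ (1 − u/U) log E 0 + (u/U) log E U`. [folklore] -/
theorem log_le_chord_div (E : ℕ → ℝ) (U : ℕ) (hU : 0 < U) (hpos : ∀ v, v ≤ U → 0 < E v)
    (hlc : ∀ v, 0 < v → v < U → E v ^ 2 ≤ E (v - 1) * E (v + 1)) (u : ℕ) (hu : u ≤ U) :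
    Real.log (E u) ≤ (1 - (u : ℝ) / U) * Real.log (E 0) + ((u : ℝ) / U) * Real.log (E U) :=
  le_chord_div (fun v => Real.log (E v)) U hU
    (fun v hv0 hvU => two_mul_log_le E v (hpos _ (by omega)) (hpos _ hvU.le) (hpos _ (by omega)) (hlc v hv0 hvU))
    u hu

end LogConvex

open LogConvex in
/-- **Chord bound for log-convex sequences.** A non-negative sequence on `[0, U]` (`0 < U`) with
`E u ^ 2 ≤ E (u-1) * E (u+1)` at interior points satisfies `E u ≤ E 0 ^ (1 - u/U) * E U ^ (u/U)` for all `u ≤ U`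
(`Real.rpow`, conventions `0 ^ 0 = 1`, `0 ^ x = 0` for `x ≠ 0`). [folklore] -/
theorem LogConvexChordBound : ∀ (E : ℕ → ℝ) (U : ℕ), 0 < U → (∀ u, u ≤ U → 0 ≤ E u) → (∀ u, 0 < u → u < U → E u ^ 2 ≤ E (u - 1) * E (u + 1)) → ∀ u, u ≤ U → E u ≤ E 0 ^ (1 - (u : ℝ) / U) * E U ^ ((u : ℝ) / U) := by
  intro E U hU hnn hlc u hu
  have hU' : (U : ℝ) ≠ 0 := by exact_mod_cast hU.ne'
  rcases Nat.eq_zero_or_pos u with rfl | hu0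
  · simp
  rcases hu.eq_or_lt with rfl | huU
  · rw [div_self hU', sub_self, Real.rpow_zero, Real.rpow_one, one_mul]
  rcases (hnn u hu).eq_or_lt with h0 | hpos
  · rw [← h0]
    exact mul_nonneg (Real.rpow_nonneg (hnn 0 (Nat.zero_le _)) _) (Real.rpow_nonneg (hnn U le_rfl) _)
  have hall := all_pos E U hnn hlc u hu0 huU hpos
  have hE0 := hall 0 (Nat.zero_le _)
  have hEU := hall U le_rfl
  have key := log_le_chord_div E U hU hall hlc u hu
  rw [Real.rpow_def_of_pos hE0, Real.rpow_def_of_pos hEU, ← Real.exp_add, ← Real.exp_log hpos, Real.exp_le_exp]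
  linarith

open LogConvex in
/-- **Exponential decay from infinity propagates to every step for log-convex sequences.** If `E ≥ 0` satisfies
`E u ^ 2 ≤ E (u-1) * E (u+1)` for all `u ≥ 1` and `E U ≤ K e^{-μ U}` for arbitrarily large `U`, then
`E u ≤ E 0 · e^{-μ u}` for every `u` (any real `K`, `μ`). [folklore] -/
theorem LogConvexExpDecay : ∀ (E : ℕ → ℝ), (∀ u, 0 ≤ E u) → (∀ u, 0 < u → E u ^ 2 ≤ E (u - 1) * E (u + 1)) → ∀ (K μ : ℝ), (∃ᶠ U in Filter.atTop, E U ≤ K * Real.exp (-(μ * U))) → ∀ u : ℕ, E u ≤ E 0 * Real.exp (-(μ * u)) := by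
  intro E hnn hlc K μ hfreq u
  rcases Nat.eq_zero_or_pos u with rfl | hu0
  · simp
  rcases (hnn u).eq_or_lt with h0 | hpos
  · rw [← h0]
    exact mul_nonneg (hnn 0) (Real.exp_pos _).le
  -- all terms are positive
  have hall : ∀ v, 0 < E v := fun v =>
    all_pos E (v + u + 1) (fun w _ => hnn w) (fun w hw _ => hlc w hw) u hu0 (by omega) hpos v (by omega)
  -- hence `K > 0`
  have hK : 0 < K := by
    obtain ⟨U, hU⟩ := hfreq.exists
    exact pos_of_mul_pos_left ((hall U).trans_le hU) (Real.exp_pos _).le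
  have hE0 := hall 0
  rw [← Real.exp_log hpos, ← Real.exp_log hE0, ← Real.exp_add, Real.exp_le_exp]
  -- goal: log (E u) ≤ log (E 0) + -(μ * u)
  refine not_lt.mp fun hcon => ?_
  set ε := Real.log (E u) - Real.log (E 0) + μ * u with hε
  have hεpos : 0 < ε := by linarith
  obtain ⟨N, hN⟩ := exists_nat_gt ((u : ℝ) * (Real.log K - Real.log (E 0)) / ε)
  obtain ⟨U, hUge, hU⟩ := hfreq.forall_exists_of_atTop (max N (u + 1))
  have hNU : N ≤ U := le_of_max_le_left hUge
  have huU : u < U := Nat.lt_of_succ_le (le_of_max_le_right hUge)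
  have hUpos : 0 < U := lt_of_le_of_lt (Nat.zero_le u) huU
  -- the log-level chord bound on `[0, U]`, cleared denominators
  have chord := le_chord (fun v => Real.log (E v)) U
    (fun v hv0 _ => two_mul_log_le E v (hall _) (hall _) (hall _) (hlc v hv0)) u huU.le
  -- `log E U ≤ log K - μ U`
  have hlogU : Real.log (E U) ≤ Real.log K - μ * U := by
    have := Real.log_le_log (hall U) hU
    rw [Real.log_mul hK.ne' (Real.exp_pos _).ne', Real.log_exp] at this
    linarith
  have h1 : (U : ℝ) * ε ≤ u * (Real.log K - Real.log (E 0)) := by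
    have := mul_le_mul_of_nonneg_left hlogU (Nat.cast_nonneg u)
    simp only [hε]
    linarith
  have h2 : (N : ℝ) * ε ≤ U * ε := mul_le_mul_of_nonneg_right (Nat.cast_le.mpr hNU) hεpos.le
  have h3 : (u : ℝ) * (Real.log K - Real.log (E 0)) < N * ε := by
    rwa [div_lt_iff₀ hεpos] at hN
  have : (0 : ℝ) < U := by exact_mod_cast hUpos
  linarith

end Summit.QuantumFields.YangMills.Theorems.CurvatureKernel

end
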